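import Literature.NumberTheory.Sieve.BombieriFriedlanderIwaniecTheorem5Weights
import Literature.NumberTheory.Sieve.VinogradovExpSumTools
import Literature.NumberTheory.Sieve.RamanujanSum
import HarnessLib

/-!
# Bombieri–Friedlander–Iwaniec 1986, §9: tools for the separation of variables (9.8)–(9.11)

Topic `Literature/NumberTheory/Sieve`.  First file of the formalisation of the PROVABLE part of
§9 ("Estimation of `ℛ₁`. Second method", pp. 227–230) of E. Bombieri, J. B. Friedlander,
H. Iwaniec, *Primes in arithmetic progressions to large moduli*, Acta Math. 156 (1986), 203–251 —
the part of the proof of **Theorem 2** (vendored as the named fact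
`Literature.NumberTheory.Sieve.BombieriFriedlanderIwaniecTheorem2` in `…Dispersion`) that is
specific to Theorem 2, whose only non-elementary input is BFI's Lemma 7 (a consequence of
Lemma 1 = the Deshouillers–Iwaniec bounds for sums of Kloosterman sums).  This file contains the
analytic tools by which BFI separate the variables `h, n₂` from the remaining ones on pp. 228–229,
in a rigorous form.  Everything here is PROVED; no named facts are introduced.

## Contents

* `BFI.bumpS`, `BFI.integrable_fourier_bumpC`, `BFI.integrable_bumpC` — the weight `f = BFI.bumpC M Y`
  (of `…Theorem5Weights`) as a Schwartz function; `𝓕f` is integrable.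
* **`BFI.bumpC_eq_integral_fourier`** (Fourier inversion `f(u) = ∫ e(ηu) 𝓕f(η) dη`),
  `BFI.integral_fourier_dilate` (`∫ e(ηu)𝓕f(η)dη = λ∫ e(η'λu) 𝓕f(λη') dη'`, `λ > 0`), and
  **`BFI.fourier_bumpC_div_eq`** (`𝓕f(h/D) = D ∫_{0<v≤V} e(−vh) f(Dv) dv` for `V ≥ 3M/D`): the two
  displays of (9.10), with Mathlib's `𝓕f(y) = ∫ f(x) e(−xy) dx` (BFI's `f̂(η) = ∫ f(ξ)e(ξη)dξ`).
* `BFI.fourierDecayConst Y = K₂/(π²Y)`, `BFI.norm_fourier_bumpC_le_decay` (`|𝓕f(ξ)| ≤ K₂/(π²Yξ²)`,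
  from the tree's two partial integrations), the Lorentzian `BFI.lorentz a b η = 2ab/(b + aη²)`,
  **`BFI.mul_norm_fourier_bumpC_le_lorentz`** (for `λ ∈ [λ₁, λ₂]`:
  `λ|𝓕f(λη)| ≤ Φ(η)` with `a = λ₂(M+2Y)`, `b = K₂/(π²Yλ₁)`), `BFI.integral_lorentz`
  (`∫ Φ = 2π√(ab)`), `BFI.integrable_lorentz` — a rigorous substitute for (9.11)
  (`∫ |f̂(ηk/(q₁q₂))| dη ≪ q₁q₂/|k|`), uniform over a dyadic block of values of `k/(q₁q₂)`.
* **`BFI.indicator_Ioc_eq_sum_e`** (`1_{a<l≤b} = T⁻¹ ∑_{t<T} e(tl/T) ∑_{a<s≤b} e(−ts/T)` when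
  `|l − s| < T`, from the orthogonality `RamanujanSum.sum_range_fourierChar_div`) — a discrete
  substitute for the integral (9.8) — and
  **`BFI.sum_range_geomBound_div_le`** (`∑_{t<T} min(V, 1/(2‖t/T‖)) ≤ 2V + T(1 + log T)`, the
  substitute for (9.9), from the well-spacing lemma of `VinogradovExpSumTools`).

## Why these forms (faithfulness to §9)

BFI detect the condition `δr ∼ R`, i.e. `q₀|k|R < |n₂ − n₁| ≤ 2q₀|k|R` (9.5), by
`∫₀¹ e((n₂−n₁)α) F(α) dα` with `∫|F| ≪ log 2N` (9.8)–(9.9), and separate `f̂(h/(δq₀q₁q₂r))` by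
Fourier inversion and the substitution `η ↦ ηk/(q₁q₂)` (9.10)–(9.11).  Since all variables are
bounded, the additive detection can be done modulo a large integer `T` (finite sums instead of an
integral, same logarithmic loss), and since the weight `|f̂(ηk/(q₁q₂))| k/(q₁q₂)` in (9.10)
depends on the outer variables `k, q₁, q₂`, a majorant uniform over a block `k/(q₁q₂) ∈ [λ₁, 8λ₁]`
is what the subsequent application of Cauchy's inequality actually requires; the Lorentzian
`2ab/(b + aη²) ≥ min(a, b/η²)` is such a majorant with `∫ = 2π√(ab) = O((M/Y)^{1/2})`.
The use of these tools is in `…DispersionR1SecondCore`.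

## References

* E. Bombieri, J. B. Friedlander, H. Iwaniec, Acta Math. 156 (1986), 203–251, §9 (9.8)–(9.11),
  pp. 228–229. [BombieriFriedlanderIwaniecActa1986]
-/

noncomputable section

open Finset Real MeasureTheory Complex
open scoped FourierTransform SchwartzMap

namespace Literature.NumberTheory.Sieve

namespace BFI

/-! ### The weight as a Schwartz function; integrability of its Fourier transform -/

/-- `bumpC M Y` as a Schwartz function (smooth with compact support). [folklore] -/
def bumpS {M Y : ℝ} (hY : 0 < Y) (hM : 0 ≤ M) : 𝓢(ℝ, ℂ) :=
  (hasCompactSupport_bumpC hY hM).toSchwartzMap (contDiff_bumpC M Y)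

/-- `bumpS` is `bumpC` pointwise. [folklore] -/
theorem bumpS_apply {M Y : ℝ} (hY : 0 < Y) (hM : 0 ≤ M) (t : ℝ) : bumpS hY hM t = bumpC M Y t := rfl

/-- `bumpS` is `bumpC` as a function. [folklore] -/
theorem coe_bumpS {M Y : ℝ} (hY : 0 < Y) (hM : 0 ≤ M) : (bumpS hY hM : ℝ → ℂ) = bumpC M Y := rfl

/-- `𝓕 α_ℂ` is integrable. [folklore] -/
theorem integrable_fourier_bumpC {M Y : ℝ} (hY : 0 < Y) (hM : 0 ≤ M) :
    Integrable (𝓕 (bumpC M Y)) := by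
  have h := (𝓕 (bumpS hY hM)).integrable (μ := volume)
  rwa [SchwartzMap.fourier_coe, coe_bumpS] at h

/-- `α_ℂ` is integrable. [folklore] -/
theorem integrable_bumpC {M Y : ℝ} (hY : 0 < Y) (hM : 0 ≤ M) : Integrable (bumpC M Y) :=
  (contDiff_bumpC M Y).continuous.integrable_of_hasCompactSupport (hasCompactSupport_bumpC hY hM)

/-- **Fourier inversion for the weight**: `α(u) = ∫ e(ηu) 𝓕α(η) dη`. [folklore] -/
theorem bumpC_eq_integral_fourier {M Y : ℝ} (hY : 0 < Y) (hM : 0 ≤ M) (u : ℝ) :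
    bumpC M Y u = ∫ η : ℝ, (𝐞 (η * u) : ℂ) * 𝓕 (bumpC M Y) η := by
  have hinv := (contDiff_bumpC M Y).continuous.fourierInv_fourier_eq (integrable_bumpC hY hM)
    (integrable_fourier_bumpC hY hM)
  have h := congr_fun hinv u
  rw [Real.fourierInv_eq] at h
  rw [← h]
  refine integral_congr_ae (Filter.Eventually.of_forall fun η => ?_)
  simp only [Circle.smul_def, smul_eq_mul, RCLike.inner_apply, conj_trivial]
  ring_nf

/-- **Dilating the inversion integral**: for `λ > 0`,
`∫ e(ηu) 𝓕α(η) dη = λ ∫ e(η'λu) 𝓕α(λη') dη'`. [folklore] -/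
theorem integral_fourier_dilate {M Y : ℝ} (lam : ℝ) (hlam : 0 < lam) (u : ℝ) :
    ∫ η : ℝ, (𝐞 (η * u) : ℂ) * 𝓕 (bumpC M Y) η =
      (lam : ℂ) * ∫ η : ℝ, (𝐞 (η * lam * u) : ℂ) * 𝓕 (bumpC M Y) (lam * η) := by
  have h := Measure.integral_comp_mul_left
    (fun η : ℝ => (𝐞 (η * u) : ℂ) * 𝓕 (bumpC M Y) η) lam
  rw [abs_of_pos (inv_pos.2 hlam)] at h
  have e1 : (fun η : ℝ => (𝐞 (η * lam * u) : ℂ) * 𝓕 (bumpC M Y) (lam * η)) =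
      fun η : ℝ => (𝐞 (lam * η * u) : ℂ) * 𝓕 (bumpC M Y) (lam * η) := by
    funext η; ring_nf
  rw [e1, h, Complex.real_smul, ← mul_assoc]
  rw [show (lam : ℂ) * ((lam⁻¹ : ℝ) : ℂ) = 1 by
    push_cast; exact mul_inv_cancel₀ (by exact_mod_cast hlam.ne')]
  rw [one_mul]

/-- **The Fourier coefficient as an integral over a bounded range**: for `D > 0`, `0 < Y ≤ M`
and `V ≥ 3M/D`, `𝓕α(h/D) = D ∫_{0 < v ≤ V} e(−vh) α(Dv) dv` (substitution `u = Dv`; `α(Dv) = 0`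
unless `0 < Dv ≤ 3M`). [cite: BombieriFriedlanderIwaniecActa1986, §9 (9.10) p. 229] -/
theorem fourier_bumpC_div_eq {M Y : ℝ} (hY : 0 < Y) (hYM : Y ≤ M) {D : ℝ} (hD : 0 < D) {V : ℝ}
    (hV : 3 * M / D ≤ V) (h : ℝ) :
    𝓕 (bumpC M Y) (h / D) =
      (D : ℂ) * ∫ v in Set.Ioc 0 V, (𝐞 (-(v * h)) : ℂ) * bumpC M Y (D * v) := by
  have hM : 0 ≤ M := hY.le.trans hYM
  rw [Real.fourier_real_eq]
  -- substitution `u = D v`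
  have hsub := Measure.integral_comp_mul_left
    (fun u : ℝ => (𝐞 (-(u * (h / D))) : ℂ) * bumpC M Y u) D
  rw [abs_of_pos (inv_pos.2 hD)] at hsub
  have e1 : (∫ u : ℝ, (𝐞 (-(u * (h / D))) : Circle) • bumpC M Y u) =
      ∫ u : ℝ, (𝐞 (-(u * (h / D))) : ℂ) * bumpC M Y u := by
    rfl
  rw [e1]
  have e2 : (∫ u : ℝ, (𝐞 (-(u * (h / D))) : ℂ) * bumpC M Y u) =
      (D : ℂ) * ∫ v : ℝ, (𝐞 (-(D * v * (h / D))) : ℂ) * bumpC M Y (D * v) := by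
    rw [hsub, Complex.real_smul, ← mul_assoc, show (D : ℂ) * ((D⁻¹ : ℝ) : ℂ) = 1 by
      push_cast; exact mul_inv_cancel₀ (by exact_mod_cast hD.ne'), one_mul]
  rw [e2]
  congr 1
  have e3 : ∀ v : ℝ, D * v * (h / D) = v * h := fun v => by field_simp
  simp_rw [e3]
  -- restrict to `0 < v ≤ V`
  symm
  refine setIntegral_eq_integral_of_forall_compl_eq_zero fun v hv => ?_
  rw [Set.mem_Ioc, not_and_or, not_lt, not_le] at hv
  have hz : bumpC M Y (D * v) = 0 := by
    refine bumpC_eq_zero hY hM ?_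
    rcases hv with hv | hv
    · left
      have : D * v ≤ 0 := mul_nonpos_of_nonneg_of_nonpos hD.le hv
      linarith
    · right
      have h1 : 3 * M < D * v := by
        rw [div_le_iff₀ hD] at hV
        nlinarith
      linarith
  rw [hz, mul_zero]


/-! ### A majorant for the dilated Fourier transforms `λ |𝓕α(λη)|`, `λ₁ ≤ λ ≤ λ₂` -/

/-- The decay constant: `|𝓕α(ξ)| ≤ B₀/ξ²` with `B₀ = K₂/(π² Y)`. [folklore] -/
def fourierDecayConst (Y : ℝ) : ℝ := derivConst 2 / (π ^ 2 * Y)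

/-- `B₀ > 0`. [folklore] -/
theorem fourierDecayConst_pos {Y : ℝ} (hY : 0 < Y) : 0 < fourierDecayConst Y := by
  unfold fourierDecayConst
  have := one_le_derivConst 2
  positivity

/-- `|𝓕α(ξ)| ≤ B₀ / ξ²` for `ξ ≠ 0` (two partial integrations). [folklore] -/
theorem norm_fourier_bumpC_le_decay {M Y : ℝ} (hY : 0 < Y) (hM : 0 ≤ M) {ξ : ℝ} (hξ : ξ ≠ 0) :
    ‖𝓕 (bumpC M Y) ξ‖ ≤ fourierDecayConst Y / ξ ^ 2 := by
  have h := norm_fourier_bumpC_le_of_ne_zero (n := 2) (by norm_num) hY hM hξ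
  refine h.trans (le_of_eq ?_)
  unfold fourierDecayConst
  have hξ2 : 0 < ξ ^ 2 := by positivity
  have habs : |ξ| ^ 2 = ξ ^ 2 := sq_abs ξ
  rw [mul_pow, mul_pow, habs]
  field_simp
  ring

/-- The smooth majorant `Φ(η) = 2ab/(b + aη²)` of `min(a, b/η²)`. [folklore] -/
def lorentz (a b η : ℝ) : ℝ := 2 * a * b / (b + a * η ^ 2)

/-- `Φ ≥ 0`. [folklore] -/
theorem lorentz_nonneg {a b : ℝ} (ha : 0 ≤ a) (hb : 0 ≤ b) (η : ℝ) : 0 ≤ lorentz a b η := by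
  unfold lorentz; positivity

/-- If `0 ≤ t ≤ a` and `t η² ≤ b` then `t ≤ 2ab/(b + aη²)`. [folklore] -/
theorem le_lorentz {a b t η : ℝ} (ha : 0 < a) (hb : 0 < b) (h1 : t ≤ a) (h2 : t * η ^ 2 ≤ b) :
    t ≤ lorentz a b η := by
  unfold lorentz
  rw [le_div_iff₀ (by positivity)]
  nlinarith [sq_nonneg η]

/-- **The majorant**: for `0 < λ₁ ≤ λ ≤ λ₂` and all `η`,
`λ |𝓕α(λη)| ≤ Φ(η)` with `a = λ₂ (M + 2Y)`, `b = B₀/λ₁`. [folklore] -/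
theorem mul_norm_fourier_bumpC_le_lorentz {M Y : ℝ} (hY : 0 < Y) (hM : 0 ≤ M)
    {lam₁ lam₂ lam : ℝ} (h₁ : 0 < lam₁) (hl₁ : lam₁ ≤ lam) (hl₂ : lam ≤ lam₂) (η : ℝ) :
    lam * ‖𝓕 (bumpC M Y) (lam * η)‖ ≤
      lorentz (lam₂ * (M + 2 * Y)) (fourierDecayConst Y / lam₁) η := by
  have hlam : 0 < lam := h₁.trans_le hl₁
  have hA : 0 < M + 2 * Y := by linarith
  have hB := fourierDecayConst_pos hY
  have hl2 : 0 < lam₂ := hlam.trans_le hl₂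
  refine le_lorentz (by positivity) (by positivity) ?_ ?_
  · exact mul_le_mul hl₂ (norm_fourier_bumpC_le hY hM _) (norm_nonneg _) (hlam.le.trans hl₂)
  · by_cases hη : η = 0
    · rw [hη]; simp only [ne_eq, OfNat.ofNat_ne_zero, not_false_eq_true, zero_pow, mul_zero]
      positivity
    · have hne : lam * η ≠ 0 := mul_ne_zero hlam.ne' hη
      have hd := norm_fourier_bumpC_le_decay hY hM hne
      calc lam * ‖𝓕 (bumpC M Y) (lam * η)‖ * η ^ 2
          ≤ lam * (fourierDecayConst Y / (lam * η) ^ 2) * η ^ 2 := by gcongr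
        _ = fourierDecayConst Y / lam := by field_simp
        _ ≤ fourierDecayConst Y / lam₁ := div_le_div_of_nonneg_left hB.le h₁ hl₁

/-- `∫ 2ab/(b + aη²) dη = 2π √(ab)` for `a, b > 0`. [folklore] -/
theorem integral_lorentz {a b : ℝ} (ha : 0 < a) (hb : 0 < b) :
    ∫ η : ℝ, lorentz a b η = 2 * π * Real.sqrt (a * b) := by
  unfold lorentz
  set s : ℝ := Real.sqrt (b / a) with hs
  have hs0 : 0 < s := Real.sqrt_pos.2 (div_pos hb ha)
  have hs2 : s ^ 2 = b / a := Real.sq_sqrt (div_pos hb ha).le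
  -- substitute `η = s u`
  have hsub := Measure.integral_comp_mul_left (fun η : ℝ => 2 * a * b / (b + a * η ^ 2)) s
  rw [abs_of_pos (inv_pos.2 hs0), smul_eq_mul] at hsub
  have key : ∀ u : ℝ, 2 * a * b / (b + a * (s * u) ^ 2) = 2 * a * (1 + u ^ 2)⁻¹ := by
    intro u
    rw [mul_pow, hs2]
    field_simp
  simp_rw [key] at hsub
  rw [integral_const_mul, integral_univ_inv_one_add_sq] at hsub
  have h2 : ∫ η : ℝ, 2 * a * b / (b + a * η ^ 2) = s * (2 * a * π) := by
    rw [eq_inv_mul_iff_mul_eq₀ hs0.ne'] at hsub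
    linarith [hsub]
  rw [h2, hs]
  have hab : Real.sqrt (a * b) = a * Real.sqrt (b / a) := by
    conv_lhs => rw [show a * b = a ^ 2 * (b / a) by field_simp]
    rw [Real.sqrt_mul (sq_nonneg a), Real.sqrt_sq ha.le]
  rw [hab]
  ring

/-- `2ab/(b + aη²)` is integrable. [folklore] -/
theorem integrable_lorentz {a b : ℝ} (ha : 0 < a) (hb : 0 < b) :
    Integrable (fun η : ℝ => lorentz a b η) := by
  have key : (fun η : ℝ => lorentz a b η) =
      fun η : ℝ => (2 * a) * (1 + (Real.sqrt (a / b) * η) ^ 2)⁻¹ := by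
    funext η
    unfold lorentz
    rw [mul_pow, Real.sq_sqrt (div_pos ha hb).le]
    field_simp
  rw [key]
  refine Integrable.const_mul ?_ _
  have h := integrable_inv_one_add_sq.comp_mul_left' (Real.sqrt_pos.2 (div_pos ha hb)).ne'
  simpa using h


/-! ### Detecting an interval condition by additive characters modulo `T` -/

/-- **Detecting `a < l ≤ b` by additive characters modulo `T`**: if `|l − s| < T` for all
`s ∈ (a, b]`, then `1_{a < l ≤ b} = T⁻¹ ∑_{t<T} e(tl/T) ∑_{a<s≤b} e(−ts/T)`.
[cite: BombieriFriedlanderIwaniecActa1986, §9 (9.8) p. 228 — variant (discrete)] -/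
theorem indicator_Ioc_eq_sum_e {T : ℕ} (hT : 0 < T) (a b : ℕ) (l : ℤ)
    (hclose : ∀ s ∈ Finset.Ioc a b, |l - (s : ℤ)| < T) :
    (if (a : ℤ) < l ∧ l ≤ (b : ℤ) then (1 : ℂ) else 0) =
      (T : ℂ)⁻¹ * ∑ t ∈ Finset.range T,
        (𝐞 ((t : ℝ) * l / T) : ℂ) * ∑ s ∈ Finset.Ioc a b, (𝐞 (-((t : ℝ) * s / T)) : ℂ) := by
  have hT0 : (T : ℂ) ≠ 0 := by exact_mod_cast hT.ne'
  -- swap the sums and use orthogonality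
  have hswap : ∑ t ∈ Finset.range T,
      (𝐞 ((t : ℝ) * l / T) : ℂ) * ∑ s ∈ Finset.Ioc a b, (𝐞 (-((t : ℝ) * s / T)) : ℂ) =
      ∑ s ∈ Finset.Ioc a b, ∑ t ∈ Finset.range T, (𝐞 ((t : ℝ) * ((l - s : ℤ)) / T) : ℂ) := by
    simp_rw [Finset.mul_sum]
    rw [Finset.sum_comm]
    refine Finset.sum_congr rfl fun s _ => Finset.sum_congr rfl fun t _ => ?_
    rw [← Circle.coe_mul, ← AddChar.map_add_eq_mul]
    congr 2
    push_cast
    ring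
  rw [hswap]
  simp_rw [RamanujanSum.sum_range_fourierChar_div hT.ne']
  have hdv : ∀ s ∈ Finset.Ioc a b, ((if (T : ℤ) ∣ (l - s : ℤ) then (T : ℂ) else 0)) =
      if (s : ℤ) = l then (T : ℂ) else 0 := by
    intro s hs
    by_cases h : (s : ℤ) = l
    · rw [if_pos h, if_pos (by rw [h, sub_self]; exact dvd_zero _)]
    · rw [if_neg h, if_neg]
      intro hd
      have habs := hclose s hs
      rcases eq_or_ne (l - s) 0 with h0 | h0
      · exact h (by linarith)
      · have := Int.le_of_dvd (abs_pos.2 h0) ((dvd_abs _ _).2 hd)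
        linarith
  rw [Finset.sum_congr rfl hdv]
  by_cases hl : (a : ℤ) < l ∧ l ≤ (b : ℤ)
  · rw [if_pos hl]
    have hlnat : ((l.toNat : ℕ) : ℤ) = l := Int.toNat_of_nonneg (by omega)
    have hmem : l.toNat ∈ Finset.Ioc a b := by
      rw [Finset.mem_Ioc]; omega
    rw [Finset.sum_eq_single_of_mem l.toNat hmem]
    · rw [if_pos hlnat, inv_mul_cancel₀ hT0]
    · intro s _ hs
      rw [if_neg]
      intro h
      apply hs
      have : (s : ℤ) = (l.toNat : ℤ) := by rw [h, hlnat]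
      exact_mod_cast this
  · rw [if_neg hl]
    rw [Finset.sum_eq_zero, mul_zero]
    intro s hs
    rw [if_neg]
    intro h
    apply hl
    rw [Finset.mem_Ioc] at hs
    omega

/-- The points `t/T`, `t < T`, are `1/T`-separated modulo `1`. [folklore] -/
theorem distInt_sub_div_ge {T : ℕ} (hT : 0 < T) {t t' : ℕ} (ht : t < T) (ht' : t' < T)
    (hne : t ≠ t') : 1 / (T : ℝ) ≤ Vinogradov.distInt ((t : ℝ) / T - (t' : ℝ) / T) := by
  have hT0 : (0 : ℝ) < T := by exact_mod_cast hT
  unfold Vinogradov.distInt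
  set n := round ((t : ℝ) / T - (t' : ℝ) / T) with hn
  -- `t - t' - nT` is a nonzero integer
  have hne' : ((t : ℤ) - t' - n * T : ℤ) ≠ 0 := by
    intro h
    have h1 : (T : ℤ) ∣ (t : ℤ) - t' := ⟨n, by linarith⟩
    rcases lt_trichotomy t t' with hlt | heq | hgt
    · have h2 : (T : ℤ) ∣ (t' : ℤ) - t := by
        have := h1.neg_right; simpa using this
      have h3 := Int.le_of_dvd (by omega) h2
      omega
    · exact hne heq
    · have h3 := Int.le_of_dvd (by omega) h1
      omega
  have h1 : (1 : ℝ) ≤ |(((t : ℤ) - t' - n * T : ℤ) : ℝ)| := by exact_mod_cast Int.one_le_abs hne'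
  have heq : (t : ℝ) / T - (t' : ℝ) / T - n = (((t : ℤ) - t' - n * T : ℤ) : ℝ) / T := by
    push_cast; field_simp
  rw [heq, abs_div, abs_of_pos hT0]
  exact div_le_div_of_nonneg_right h1 hT0.le

/-- **Average of the geometric-sum majorant over the points `t/T`**:
`∑_{t<T} min(V, 1/(2‖t/T‖)) ≤ 2V + T(1 + log T)` (`T ≥ 1`, `V ≥ 0`).
[cite: BombieriFriedlanderIwaniecActa1986, §9 (9.9) p. 228 — variant (discrete)] -/
theorem sum_range_geomBound_div_le {T : ℕ} (hT : 0 < T) {V : ℝ} (hV : 0 ≤ V) :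
    ∑ t ∈ Finset.range T, Vinogradov.geomBound V ((t : ℝ) / T) ≤
      2 * V + T * (1 + Real.log T) := by
  have hT0 : (0 : ℝ) < T := by exact_mod_cast hT
  have h := Vinogradov.sum_geomBound_le_of_separated (Finset.range T) (fun t : ℕ => (t : ℝ) / T)
    (δ := 1 / (T : ℝ)) (by positivity) (m := T) (by
      rw [show 1 / (2 * (1 / (T : ℝ))) = T / 2 by field_simp]; linarith) (fun i hi j hj hij =>
      distInt_sub_div_ge hT (Finset.mem_range.1 hi) (Finset.mem_range.1 hj) hij) hV
  rw [one_div_one_div] at h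
  exact h

end BFI

end Literature.NumberTheory.Sieve
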